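import Summits.ABC.IUTFork.Cor312LogKummerGlobal
import Summits.ABC.IUTFork.Cor312GapGlobalCountermodel
import Summits.ABC.IUTFork.Cor312GlobalTransportNotNecessary
import Summits.ABC.IUTFork.Cor312VolumeTransportHierarchy
import HarnessLib

/-!
# [IUTchIII] Cor. 3.12 — WEAKEN-TO-PRINT (ADJUDICATION-SPEC v2.3 (G-PINNED-2) (c), PR-4): the print-level companion
# of Team B's STRONGER-THAN-PRINT typings is the hull-level global transport — and it IS the Corollary's inequality

Record-only file (D-0012) of the abc-iut cell (PR-4 «WEAKEN-TO-PRINT», owners Team B c312-11 and c312-12 + the skeleton seat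
abc-iut-skel; this is the skeleton seat's typing half, gen 6); TAKES NO SIDE. Lane A2's verdict of record
(plan/L6/FAITHFUL-A2.md; ADJUDICATION-SPEC §2 (G-PINNED)) grades three typings STRONGER-THAN-PRINT:
`Cor312Vol.QFrobComparison` (per packet AND pre-hull), `Cor312Vol.GlobalVolumeTransport` (global but pre-hull),
`Cor312Vol.SoundAtInput` (∀-input). The coordinator's add-on (c) asks for their PRINT-LEVEL COMPANIONS «in the same
round», every pinned-round theorem to be stated against the companions. Print's comparison ([IUTchIII] Cor. 3.12
proof, Step (xi-g), kurims `paper:url-4b091feeb646` p. 184 l. 30–34; statement p. 173 l. 43 – p. 174 l. 18) is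
GLOBAL (procession-normalised, `v_ℚ`-summed) and HULL-LEVEL (the holomorphic hull of the union of the possible
images, p. 174 l. 50–58). This file types that companion and settles what it is:

* `Cor312Vol.GlobalHullTransport P` — Team B's `GlobalVolumeTransport` with each single Kummer image
  `thetaRegion (m i v_ℚ)` replaced by the packet HULL `thetaHull` of the union of ALL possible images (so no choice
  `m` remains), the hulls being defined and the global sum finitely supported: «`−|log(q)|` ≤ the
  procession-normalised `v_ℚ`-sum of the log-volumes of the hulls». This is the print-level companion of BOTH
  `QFrobComparison` (lift per-packet → global, single image → hull) and `GlobalVolumeTransport` (single image → hull).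
* **`globalHullTransport_iff_statement : GlobalHullTransport P ↔ P.Statement`** — PROVED, for EVERY frozen
  setting, no hypothesis: weakened to print's quantifier and hull level, Team B's input IS the Corollary's own
  conclusion («`−|log(Θ)| ∈ ℝ` and `−|log(Θ)| ≥ −|log(q)|`»). The same collapse as Team A's LEVEL 0
  (`InputStrip.gapGlobal_iff_statement`, p413284; `Cor312Vol.soundAtPilot_iff_statement`, p414839):
  `globalHullTransport_iff_gapGlobal`. HONESTY CLAUSE for the 12:30Z block: over the frozen fields there is NO
  print-level (global, hull-level) q-vs-Θ comparison strictly between Team B's typed inputs and the Statement; the B-route's content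
  beyond print is exactly its pre-hull / per-packet strength.
* `globalHullTransport_of_globalVolumeTransport` / `_of_volumeTransport` / `_of_qFrobComparison` — every B-form
  implies the companion (one line each through the landed B chain p411119/p411648/p413209/p414039), so every
  pinned-round theorem stated against a B-form restates against the companion; and STRICTLY:
  `globalHullTransport_not_imp_globalVolumeTransport` (w5-d232's `gtSetting`, p414138) and
  `globalHullTransport_not_imp_qFrobComparison` (w5-d087's `qfSetting`, p413378/p413793) — the companion holds
  where the B-forms fail.
* WHY the pre-hull forms cannot be weakened to anything print-level short of the Statement (kernel, real packets):
  skeleton XXVIb `PacketReal.not_singleImageReading_thetaWeights` (p417570) — at a summand of c312-3's real prime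
  packet with sharp (Ind3)-data, a SINGLE image (any admissible sub-region of any (Ind1)(Ind2)-orbit member) never
  carries the q-pilot region's log-volume at a bad place for `j ≥ 2`, by the Θ-weights alone; the inflation the
  printed inequality needs is the HULL's (XXVI `PacketReal.thetaHull_bound`, p417081; XVIII `cor312_iff_inflation`).
* `SoundAtInput` ↦ its PILOT instance: already typed and proved equal to the Statement (`soundAtPilot_iff_statement`
  p414839, `soundAtThetaPilot_iff_statement` p413799, LEVEL 0 `gapGlobal_iff_statement` p413284) — cited, nothing new.

Nothing here asserts that any form holds or fails at the intended setting; no new Prop FACT (one bookkeeping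
definition over the frozen fields + theorems). [claim: Mochizuki2012, status: disputed] for the quoted text;
[cite: ScholzeStix2018, §2.2 pp. 9–10] for where the objection sits. typed ≠ proved; no side taken.
-/

noncomputable section

namespace Summit.ABC

namespace IUTFork

namespace Cor312Vol

open Thm311 Cor312 Cor312.Setting Literature.IUT.LogThetaLattice

variable {T : ThetaIndex} {S : Situation T} (P : Cor312.Setting S)

/-! ## 1. The print-level companion: hull-level, global -/

/-- **HULL-LEVEL GLOBAL TRANSPORT — the print-level companion of Team B's inputs** ((xi-g) p. 184 l. 30–34
read at print's quantifier and hull level): every packet hull `^{n,∘}𝒰_{j,v_ℚ}` of the union of the possible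
images is defined, the global sums are finitely supported, and `−|log(q)|` is at most the procession-normalised
`v_ℚ`-sum of the log-volumes of the HULLS. Team B's `GlobalVolumeTransport` with `thetaRegion (m i v_ℚ)` ↦
`thetaHull`; HYPOTHESIS-shaped, never asserted. [claim: Mochizuki2012, status: disputed] -/
@[claim "Mochizuki2012" "disputed"]
def GlobalHullTransport : Prop :=
  (∀ (i : Fin T.lstar) (vQ : T.VQ), P.HullDefined (labelSucc i) vQ) ∧
    (∀ i : Fin T.lstar, (Function.support fun vQ : T.VQ =>
      (S.D P.n).logvol (labelSucc i) vQ (P.thetaHull (labelSucc i) vQ)).Finite) ∧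
    P.negLogQ ≤ processionNormalized fun i : Fin T.lstar => ∑ᶠ vQ : T.VQ,
      (S.D P.n).logvol (labelSucc i) vQ (P.thetaHull (labelSucc i) vQ)

/-- `ThetaFinite` gives `HullDefined` at every label of `𝔽_l^⋇` (any situation; c312-7's
`Cor312.Setting.hullDefined_of_thetaFinite` is the same statement over a lattice situation — private copy to
serve a general `Situation`). [folklore] -/
private theorem hullDefined_of_thetaFinite_any (h : P.ThetaFinite) (i : Fin T.lstar) (vQ : T.VQ) :
    P.HullDefined (labelSucc i) vQ := by
  by_contra hb
  exact h.1 i vQ (by unfold Setting.thetaLocal; rw [if_neg hb])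

/-- Under `HullDefined` the local term is the real log-volume of the hull (any situation; private copy of
c312-7's lattice-situation `Cor312.Setting.thetaLocal_untopD`). [folklore] -/
private theorem thetaLocal_untopD_any {j : T.Label} {vQ : T.VQ} (h : P.HullDefined j vQ) :
    (P.thetaLocal j vQ).untopD 0 = (S.D P.n).logvol j vQ (P.thetaHull j vQ) := by
  unfold Setting.thetaLocal
  rw [if_pos h, WithTop.untopD_coe]

/-- `ThetaFinite` ("`−|log(Θ)| ∈ ℝ`") is exactly: every hull defined and the hull-volume sums finitely supported.
[folklore] -/
theorem thetaFinite_iff_hulls :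
    P.ThetaFinite ↔ (∀ (i : Fin T.lstar) (vQ : T.VQ), P.HullDefined (labelSucc i) vQ) ∧
      ∀ i : Fin T.lstar, (Function.support fun vQ : T.VQ =>
        (S.D P.n).logvol (labelSucc i) vQ (P.thetaHull (labelSucc i) vQ)).Finite := by
  constructor
  · intro h
    have hd : ∀ (i : Fin T.lstar) (vQ : T.VQ), P.HullDefined (labelSucc i) vQ :=
      fun i vQ => hullDefined_of_thetaFinite_any P h i vQ
    refine ⟨hd, fun i => ?_⟩
    have hfun : (fun vQ : T.VQ => (P.thetaLocal (labelSucc i) vQ).untopD 0) =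
        fun vQ => (S.D P.n).logvol (labelSucc i) vQ (P.thetaHull (labelSucc i) vQ) :=
      funext fun vQ => thetaLocal_untopD_any P (hd i vQ)
    rw [← hfun]
    exact h.2 i
  · rintro ⟨hd, hfin⟩
    refine ⟨fun i vQ => ?_, fun i => ?_⟩
    · unfold Setting.thetaLocal
      rw [if_pos (hd i vQ)]
      exact WithTop.coe_ne_top
    · have hfun : (fun vQ : T.VQ => (P.thetaLocal (labelSucc i) vQ).untopD 0) =
          fun vQ => (S.D P.n).logvol (labelSucc i) vQ (P.thetaHull (labelSucc i) vQ) :=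
        funext fun vQ => thetaLocal_untopD_any P (hd i vQ)
      rw [hfun]
      exact hfin i

/-- Under "every hull defined", the displayed `−|log(Θ)|`-sum is the hull-volume sum. [folklore] -/
theorem thetaLocal_sums_eq (hd : ∀ (i : Fin T.lstar) (vQ : T.VQ), P.HullDefined (labelSucc i) vQ) :
    (fun i : Fin T.lstar => ∑ᶠ vQ : T.VQ, (P.thetaLocal (labelSucc i) vQ).untopD 0) =
      fun i : Fin T.lstar => ∑ᶠ vQ : T.VQ, (S.D P.n).logvol (labelSucc i) vQ (P.thetaHull (labelSucc i) vQ) :=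
  funext fun i => finsum_congr fun vQ => thetaLocal_untopD_any P (hd i vQ)

/-! ## 2. WEAKEN-TO-PRINT collapses onto the Corollary -/

/-- **The print-level companion IS the Corollary's conclusion** — for every frozen setting, no hypothesis: the
hull-level global transport holds iff «`−|log(Θ)| ∈ ℝ` and `−|log(Θ)| ≥ −|log(q)|`» as typed (c312-7
`Cor312.Setting.Statement`). [claim: Mochizuki2012, status: disputed] -/
theorem globalHullTransport_iff_statement : GlobalHullTransport P ↔ P.Statement := by
  constructor
  · rintro ⟨hd, hfin, hle⟩
    have hTF : P.ThetaFinite := (thetaFinite_iff_hulls P).mpr ⟨hd, hfin⟩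
    rw [P.statement_iff_of_thetaFinite hTF, thetaLocal_sums_eq P hd]
    exact hle
  · intro hst
    have hTF : P.ThetaFinite := by
      by_contra h
      exact P.not_statement_of_not_thetaFinite h hst
    obtain ⟨hd, hfin⟩ := (thetaFinite_iff_hulls P).mp hTF
    refine ⟨hd, hfin, ?_⟩
    have hle := (P.statement_iff_of_thetaFinite hTF).mp hst
    rw [thetaLocal_sums_eq P hd] at hle
    exact hle

/-- … and therefore coincides with Team A's LEVEL 0 gap `GapGlobal` of any strip algorithm (skeleton XXV/XXVb)
whenever `−|log(Θ)|` is finite: the two teams' print-level residues are ONE statement. [claim: Mochizuki2012, status: disputed] -/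
theorem globalHullTransport_iff_gapGlobal (A : InputStrip.StripAlgorithm P) (h : P.ThetaFinite) :
    GlobalHullTransport P ↔ A.GapGlobal := by
  rw [globalHullTransport_iff_statement, InputStrip.gapGlobal_iff_statement A h]

variable {P}

/-! ## 3. Every Team-B form implies the companion (so pinned-round theorems restate against it) -/

/-- The global pre-hull form implies the hull-level companion. [claim: Mochizuki2012, status: disputed] -/
theorem globalHullTransport_of_globalVolumeTransport (H : BridgeHyps P) (hadm : ThetaRegionsAdm P)
    (h : GlobalVolumeTransport P) : GlobalHullTransport P :=
  (globalHullTransport_iff_statement P).mpr (h.statement_of H hadm)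

/-- The per-packet pre-hull form implies the hull-level companion. [claim: Mochizuki2012, status: disputed] -/
theorem globalHullTransport_of_volumeTransport (H : BridgeHyps P) (hadm : ThetaRegionsAdm P)
    (h : VolumeTransport P) : GlobalHullTransport P :=
  (globalHullTransport_iff_statement P).mpr (statement_of_volumeTransport P H hadm h)

/-- The residual B-input `QFrobComparison` (per packet, pre-hull, holomorphic side; needs Thm. 3.11 (ii) (a)
`KummerA` of the column) implies the hull-level companion. [claim: Mochizuki2012, status: disputed] -/
theorem globalHullTransport_of_qFrobComparison {S' : LatticeSituation T} {P : Cor312.Setting S'.toSituation}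
    (H : BridgeHyps P) (hka : (S'.col P.n).KummerA (S'.D P.n)) (hadm : ThetaRegionsAdm P)
    (h : QFrobComparison P) : GlobalHullTransport P :=
  (globalHullTransport_iff_statement P).mpr (statement_of_qFrobComparison P H hka hadm h)

/-- Termwise: each single Kummer image volume is dominated by the hull volume of its packet (B1's
`logvol_thetaRegion_le_thetaLocal`, restated on the hull) — the companion is the B-form with every term enlarged.
[folklore] -/
theorem logvol_thetaRegion_le_logvol_thetaHull (H : BridgeHyps P) (hadm : ThetaRegionsAdm P) (m : ℤ)
    (i : Fin T.lstar) (vQ : T.VQ) :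
    (S.D P.n).logvol (labelSucc i) vQ (P.thetaRegion m (labelSucc i) vQ) ≤
      (S.D P.n).logvol (labelSucc i) vQ (P.thetaHull (labelSucc i) vQ) := by
  have h := logvol_thetaRegion_le_thetaLocal H hadm m i vQ
  rwa [thetaLocal_untopD_any P (hullDefined_of_thetaFinite_any P H.finite i vQ)] at h

/-! ## 4. … and STRICTLY: the companion holds where the Team-B forms fail -/

/-- **Companion ⇏ `GlobalVolumeTransport`** (interface level): in w5-d232's `gtSetting` (p414138) the Statement —
hence the hull-level companion — holds, with all bridge hypotheses and admissible Kummer images, while the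
pre-hull global transport fails for EVERY family of lattice positions. [folklore] -/
theorem globalHullTransport_not_imp_globalVolumeTransport :
    ∃ (T : ThetaIndex) (S : Situation T) (P : Cor312.Setting S),
      BridgeHyps P ∧ ThetaRegionsAdm P ∧ GlobalHullTransport P ∧ ¬ GlobalVolumeTransport P := by
  refine ⟨_, _, GlobalTransportWitness.gtSetting, GlobalTransportWitness.gtSetting_bridgeHyps,
    GlobalTransportWitness.gt_thetaRegionsAdm,
    (globalHullTransport_iff_statement _).mpr GlobalTransportWitness.gt_statement, ?_⟩
  rintro ⟨mf, -, hle⟩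
  exact GlobalTransportWitness.gt_not_globalVolumeTransport mf hle

/-- **Companion ⇏ `QFrobComparison`** (interface level): in w5-d087's `qfSetting` (p413378/p413793) the Statement
— hence the companion — holds while the residual B-input fails. [folklore] -/
theorem globalHullTransport_not_imp_qFrobComparison :
    ∃ (T : ThetaIndex) (F : FullSituation T) (P : Cor312.Setting F.toLatticeSituation.toSituation),
      GlobalHullTransport P ∧ ¬ QFrobComparison (S' := F.toLatticeSituation) P :=
  ⟨_, QFrobWitness.qfFull, QFrobWitness.qfSetting,
    (globalHullTransport_iff_statement _).mpr QFrobWitness.qf_statement_via_global,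
    QFrobWitness.qf_not_qFrobComparison⟩

/-! ## 5. The (G3) countermodel of record against the companion (one line) -/

/-- Team A's gap witness (typed Thm. 3.11 in full, all bridge hypotheses, `|log(q)| > 0`, Statement false;
p411346) refutes the companion too — as it must, the companion being the Statement.
[claim: Mochizuki2012, status: disputed] -/
theorem thm311_bridgeHyps_not_imp_globalHullTransport :
    ∃ (T : ThetaIndex) (S'' : FullSituation T) (P : Cor312.Setting S''.toSituation),
      S''.Statement ∧ BridgeHyps P ∧ P.AbsLogQPos ∧ ¬ GlobalHullTransport P :=
  ⟨_, GapWitness.gapFull, GapWitness.gapSetting, GapWitness.gapFull_statement, GapWitness.gapSetting_bridgeHyps,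
    GapWitness.gapSetting_absLogQPos,
    fun h => GapWitness.gapSetting_not_statement ((globalHullTransport_iff_statement _).mp h)⟩

end Cor312Vol

end IUTFork

end Summit.ABC

end
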